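import Mathlib
import HarnessLib
import Summits.Ventures.LatticeQCDFlow.Exactness.UniformAngleCauchy

/-!
# Kennedy–Pendleton's exponent `−(log r₁ + cos²(2πr₂) log r₃)` of three uniforms is a Gamma(3/2) variable

HONEST FRAMING: exact (Metropolis-corrected) sampling algorithms for lattice gauge theory;
figures of merit are autocorrelation/cost numbers at stated couplings and volumes; no
continuum-physics claim.

Venture `LatticeQCDFlow` (cell pub-lqcd), topic `Exactness`, FANOUT row 9 (eng-latcore, the
engine `latflow.core`).  NEW WORK of the cell over Mathlib and row 9's `UniformAngleCauchy.lean`;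
nothing here is cited as a fact.  Printed counterparts, NAMED ONLY: Kennedy–Pendleton, Phys.
Lett. B 156 (1985) 393; Gattringer–Lang 2010 §4.1.

The engine's Kennedy–Pendleton branch (`csrc/latcore_template.c` `sample_a0`, `bt ≥ 2`;
`updates.py` `sample_a0_kp`) draws three uniforms and forms
`λ² = −(log r₁ + cos²(2π r₂) log r₃)/(2·bt)`.  This file proves, in idealised real arithmetic,
that the exponent `kpX (r₁, r₂, r₃) = −(log r₁ + cos²(2π r₂) log r₃)` has the law
`(2/√π) √s e^{−s} ds` on `(0, ∞)`, i.e. Mathlib's `gammaMeasure (3/2) 1`: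

* **`lintegral_cos_sq_mul_neg_log`** — `cos²(2πu)·(−log r)` of two independent uniforms has the
  Gamma(½) law `e^{−y} dy/√(πy)`: Tonelli, the exponential transfer and scaling of
  `UniformAngleCauchy.lean`, and its Gamma(½) kernel `∫ e^{−y sec²} sec² du = e^{−y}/√(πy)`;
* **`lintegral_exp_conv_halfGamma`** — adding an independent unit exponential:
  `Exp(1) ∗ Gamma(½) = Gamma(3/2)`, elementary because the exponentials combine
  (`∫₀ˢ dy/√y = 2√s`);
* **`lintegral_kpX`** — for every measurable `g ≥ 0`,
  `∫ g(kpX r) d(unitLaw ⊗ unitLaw ⊗ unitLaw)(r) = ∫_{(0,∞)} (2/√π)√s e^{−s} g(s) ds`;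
* **`map_kpX_unitLaw3`** — the same as a law: `(unitLaw³).map kpX = gammaMeasure (3/2) 1`.

The acceptance step and the output `a₀ = 1 − 2λ²` are in `KennedyPendletonSampler.lean`.
-/

namespace Summit.Ventures.LatticeQCDFlow.Exactness

open MeasureTheory Measure Set Real
open scoped ENNReal

/-! ## §1 `cos²(2πu) · (−log r)` is a Gamma(½) variable -/

/-- The zero set of `u ↦ cos(2πu)` is Lebesgue-null, so `cos(2πu) ≠ 0` for a.e. `u ∼ unitLaw`. -/
theorem ae_cos_two_pi_mul_ne_zero : ∀ᵐ u ∂unitLaw, Real.cos (2 * π * u) ≠ 0 := by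
  refine ae_restrict_of_ae ?_
  rw [ae_iff]
  simp only [ne_eq, not_not]
  refine measure_mono_null (t := range fun k : ℤ => (2 * (k : ℝ) + 1) / 4) ?_
    ((Set.countable_range _).measure_zero _)
  intro u hu
  obtain ⟨k, hk⟩ := Real.cos_eq_zero_iff.mp hu
  refine ⟨k, ?_⟩
  have hπ : π ≠ 0 := pi_ne_zero
  field_simp at hk ⊢
  linarith

/-- **`cos²(2πu)·(−log r)` of two independent uniforms is Gamma(½).**  For every measurable
`g ≥ 0`, `∫ g(cos²(2πu)·(−log r)) d(unitLaw ⊗ unitLaw) = ∫_{(0,∞)} e^{−y}/√(πy) · g(y) dy`. -/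
theorem lintegral_cos_sq_mul_neg_log {g : ℝ → ℝ≥0∞} (hg : Measurable g) :
    ∫⁻ p, g (Real.cos (2 * π * p.1) ^ 2 * -Real.log p.2) ∂(unitLaw.prod unitLaw) =
      ∫⁻ y in Ioi 0, ENNReal.ofReal (Real.exp (-y) / Real.sqrt (π * y)) * g y := by
  rw [lintegral_prod _ (by fun_prop : Measurable fun p : ℝ × ℝ =>
    g (Real.cos (2 * π * p.1) ^ 2 * -Real.log p.2)).aemeasurable]
  -- the `r`-integral: `−log r` is exponential
  have h1 : ∀ u : ℝ, ∫⁻ r, g (Real.cos (2 * π * u) ^ 2 * -Real.log r) ∂unitLaw =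
      ∫⁻ x in Ioi 0, ENNReal.ofReal (Real.exp (-x)) * g (Real.cos (2 * π * u) ^ 2 * x) :=
    fun u => lintegral_neg_log_unitLaw (fun x => g (Real.cos (2 * π * u) ^ 2 * x))
  simp_rw [h1]
  -- scaling, for a.e. `u`
  have h2 : ∀ᵐ u ∂unitLaw, ∫⁻ x in Ioi 0, ENNReal.ofReal (Real.exp (-x)) * g (Real.cos (2 * π * u) ^ 2 * x) =
      ∫⁻ y in Ioi 0, ENNReal.ofReal (Real.exp (-(y / Real.cos (2 * π * u) ^ 2)) / Real.cos (2 * π * u) ^ 2) * g y :=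
    ae_cos_two_pi_mul_ne_zero.mono fun u hu => lintegral_exp_comp_mul (by positivity) g
  rw [lintegral_congr_ae h2]
  -- swap the order of integration (Tonelli)
  rw [lintegral_lintegral_swap (by fun_prop : Measurable fun p : ℝ × ℝ =>
    ENNReal.ofReal (Real.exp (-(p.2 / Real.cos (2 * π * p.1) ^ 2)) / Real.cos (2 * π * p.1) ^ 2) * g p.2).aemeasurable]
  refine setLIntegral_congr_fun measurableSet_Ioi fun y hy => ?_
  rw [lintegral_mul_const _ (by fun_prop), lintegral_halfGamma_kernel_unitLaw hy]

/-! ## §2 Adding an independent unit exponential: `Exp(1) ∗ Gamma(½) = Gamma(3/2)` -/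

/-- `∫_{(0,s)} dx/√(πx) = 2√s/√π` as a Lebesgue integral (`s > 0`). -/
theorem lintegral_Ioo_inv_sqrt {s : ℝ} (hs : 0 < s) :
    ∫⁻ x in Ioo 0 s, ENNReal.ofReal (1 / Real.sqrt (π * x)) = ENNReal.ofReal (2 * Real.sqrt s / Real.sqrt π) := by
  have hsπ : 0 < Real.sqrt π := Real.sqrt_pos.mpr pi_pos
  -- rewrite the integrand as `(1/√π) · x^(−1/2)` on `(0, s)`
  have hpt : ∀ x ∈ Ioo 0 s, ENNReal.ofReal (1 / Real.sqrt (π * x)) =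
      ENNReal.ofReal (1 / Real.sqrt π) * ENNReal.ofReal (x ^ (-(1 / 2 : ℝ))) := by
    intro x hx
    rw [← ENNReal.ofReal_mul (by positivity), Real.sqrt_mul pi_pos.le, Real.rpow_neg hx.1.le,
      ← Real.sqrt_eq_rpow]
    congr 1
    field_simp
  rw [setLIntegral_congr_fun measurableSet_Ioo hpt, lintegral_const_mul _ (by fun_prop)]
  have hint : IntegrableOn (fun x : ℝ => x ^ (-(1 / 2 : ℝ))) (Ioo 0 s) :=
    ((intervalIntegral.intervalIntegrable_rpow' (a := 0) (b := s) (by norm_num)).1).mono_set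
      Ioo_subset_Ioc_self
  rw [← ofReal_integral_eq_lintegral_ofReal hint
      ((ae_restrict_iff' measurableSet_Ioo).mpr (ae_of_all _ fun x hx => by
        exact Real.rpow_nonneg hx.1.le _)),
    ← ENNReal.ofReal_mul (by positivity), ← integral_Ioc_eq_integral_Ioo,
    ← intervalIntegral.integral_of_le hs.le, integral_rpow (Or.inl (by norm_num))]
  congr 1
  rw [show (-(1 / 2 : ℝ) + 1) = 1 / 2 by norm_num, Real.zero_rpow (by norm_num), ← Real.sqrt_eq_rpow,
    sub_zero]
  field_simp

/-- The inner integral of the convolution: for `s > 0`,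
`∫_{(0,∞)} e^{−x} · 1[x < s] e^{−(s−x)}/√(π(s−x)) dx = (2/√π) √s e^{−s}`. -/
theorem lintegral_exp_halfGamma_shift {s : ℝ} (hs : 0 < s) :
    ∫⁻ x in Ioi 0, ENNReal.ofReal (Real.exp (-x)) *
        (Ioi 0).indicator (fun y => ENNReal.ofReal (Real.exp (-y) / Real.sqrt (π * y))) (s - x) =
      ENNReal.ofReal (2 / Real.sqrt π * Real.sqrt s * Real.exp (-s)) := by
  -- restrict to `(0, s)`: the indicator kills `x ≥ s`
  have hsplit : ∫⁻ x in Ioi 0, ENNReal.ofReal (Real.exp (-x)) *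
        (Ioi 0).indicator (fun y => ENNReal.ofReal (Real.exp (-y) / Real.sqrt (π * y))) (s - x) =
      ∫⁻ x in Ioo 0 s, ENNReal.ofReal (Real.exp (-s) / Real.sqrt (π * (s - x))) := by
    rw [← lintegral_indicator measurableSet_Ioi, ← lintegral_indicator measurableSet_Ioo]
    refine lintegral_congr fun x => ?_
    by_cases hx0 : 0 < x
    · by_cases hxs : x < s
      · rw [indicator_of_mem (mem_Ioi.mpr hx0), indicator_of_mem (mem_Ioi.mpr (sub_pos.mpr hxs)),
          indicator_of_mem (show x ∈ Ioo 0 s from ⟨hx0, hxs⟩), ← ENNReal.ofReal_mul (Real.exp_pos _).le]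
        congr 1
        rw [mul_div_assoc', ← Real.exp_add]
        ring_nf
      · rw [indicator_of_mem (mem_Ioi.mpr hx0), indicator_of_notMem (by simpa using hxs),
          indicator_of_notMem (fun h => hxs h.2), mul_zero]
    · rw [indicator_of_notMem (by simpa using hx0), indicator_of_notMem (fun h => hx0 h.1)]
  rw [hsplit]
  -- reflect `x ↦ s − x` on `(0, s)`
  have himg : (fun x : ℝ => s - x) '' Ioo 0 s = Ioo 0 s := by
    ext x
    constructor
    · rintro ⟨y, hy, rfl⟩
      exact (show s - y ∈ Ioo 0 s from ⟨by linarith [hy.2], by linarith [hy.1]⟩)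
    · intro hx
      exact ⟨s - x, (show s - x ∈ Ioo 0 s from ⟨by linarith [hx.2], by linarith [hx.1]⟩), by ring⟩
  have hderiv : ∀ x ∈ Ioo 0 s, HasDerivWithinAt (fun x : ℝ => s - x) (-1) (Ioo 0 s) x :=
    fun x _ => ((hasDerivAt_id' x).const_sub s).hasDerivWithinAt
  have hinj : InjOn (fun x : ℝ => s - x) (Ioo 0 s) := fun x _ y _ h => by simpa using h
  have hrefl := lintegral_image_eq_lintegral_abs_deriv_mul measurableSet_Ioo hderiv hinj
    (fun x => ENNReal.ofReal (Real.exp (-s) / Real.sqrt (π * x)))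
  simp only [himg, abs_neg, abs_one, ENNReal.ofReal_one, one_mul] at hrefl
  rw [← hrefl]
  -- factor the constant and integrate `1/√(πx)`
  have hpt : ∀ x : ℝ, ENNReal.ofReal (Real.exp (-s) / Real.sqrt (π * x)) =
      ENNReal.ofReal (Real.exp (-s)) * ENNReal.ofReal (1 / Real.sqrt (π * x)) := by
    intro x
    rw [← ENNReal.ofReal_mul (Real.exp_pos _).le, mul_one_div]
  simp_rw [hpt]
  rw [lintegral_const_mul _ (by fun_prop), lintegral_Ioo_inv_sqrt hs, ← ENNReal.ofReal_mul (Real.exp_pos _).le]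
  congr 1
  ring

/-- **`Exp(1) ∗ Gamma(½) = Gamma(3/2)`.**  For every measurable `g ≥ 0`,
`∫_{(0,∞)} e^{−x} ∫_{(0,∞)} e^{−y}/√(πy) g(x+y) dy dx = ∫_{(0,∞)} (2/√π)√s e^{−s} g(s) ds`. -/
theorem lintegral_exp_conv_halfGamma {g : ℝ → ℝ≥0∞} (hg : Measurable g) :
    ∫⁻ x in Ioi 0, ENNReal.ofReal (Real.exp (-x)) *
        ∫⁻ y in Ioi 0, ENNReal.ofReal (Real.exp (-y) / Real.sqrt (π * y)) * g (x + y) =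
      ∫⁻ s in Ioi 0, ENNReal.ofReal (2 / Real.sqrt π * Real.sqrt s * Real.exp (-s)) * g s := by
  have hφm : Measurable fun y : ℝ => ENNReal.ofReal (Real.exp (-y) / Real.sqrt (π * y)) := by
    fun_prop
  -- shift the inner integral: `y = s − x`
  have hshift : ∀ x : ℝ,
      ∫⁻ y in Ioi 0, ENNReal.ofReal (Real.exp (-y) / Real.sqrt (π * y)) * g (x + y) =
        ∫⁻ s, (Ioi 0).indicator (fun y => ENNReal.ofReal (Real.exp (-y) / Real.sqrt (π * y))) (s - x) *
          g s := by
    intro x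
    rw [← lintegral_indicator measurableSet_Ioi,
      ← lintegral_sub_right_eq_self (fun y => (Ioi 0).indicator
        (fun y => ENNReal.ofReal (Real.exp (-y) / Real.sqrt (π * y)) * g (x + y)) y) x]
    refine lintegral_congr fun s => ?_
    by_cases h : s - x ∈ Ioi 0
    · rw [indicator_of_mem h, indicator_of_mem h, show x + (s - x) = s by ring]
    · rw [indicator_of_notMem h, indicator_of_notMem h, zero_mul]
  simp_rw [hshift]
  -- swap the order of integration
  have hmeas : Measurable fun p : ℝ × ℝ => ENNReal.ofReal (Real.exp (-p.1)) *
      ((Ioi 0).indicator (fun y => ENNReal.ofReal (Real.exp (-y) / Real.sqrt (π * y))) (p.2 - p.1) *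
        g p.2) := by
    refine (by fun_prop : Measurable fun p : ℝ × ℝ => ENNReal.ofReal (Real.exp (-p.1))).mul
      (Measurable.mul ?_ (hg.comp measurable_snd))
    exact (hφm.indicator measurableSet_Ioi).comp (measurable_snd.sub measurable_fst)
  simp_rw [← lintegral_const_mul' _ _ ENNReal.ofReal_ne_top]
  rw [lintegral_lintegral_swap hmeas.aemeasurable]
  conv_rhs => rw [← lintegral_indicator measurableSet_Ioi]
  refine lintegral_congr fun s => ?_
  by_cases hs : 0 < s
  · rw [indicator_of_mem (mem_Ioi.mpr hs)]
    simp_rw [← mul_assoc]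
    have hms : Measurable fun x : ℝ => ENNReal.ofReal (Real.exp (-x)) *
        (Ioi 0).indicator (fun y => ENNReal.ofReal (Real.exp (-y) / Real.sqrt (π * y))) (s - x) :=
      (by fun_prop : Measurable fun x : ℝ => ENNReal.ofReal (Real.exp (-x))).mul
        ((hφm.indicator measurableSet_Ioi).comp (measurable_const.sub measurable_id))
    rw [lintegral_mul_const _ hms, lintegral_exp_halfGamma_shift hs]
  · rw [indicator_of_notMem (fun h : s ∈ Ioi 0 => hs h)]
    refine (setLIntegral_congr_fun measurableSet_Ioi (g := fun _ => 0) fun x (hx : 0 < x) => ?_).trans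
      lintegral_zero
    have hsx : s - x ∉ Ioi (0 : ℝ) := fun h => hs (by have := mem_Ioi.mp h; linarith)
    simp only [indicator_of_notMem hsx, zero_mul, mul_zero]

/-! ## §3 The Kennedy–Pendleton exponent of three uniforms is Gamma(3/2) -/

/-- Three independent uniform deviates `(r₁, r₂, r₃)`. -/
noncomputable def unitLaw3 : Measure (ℝ × ℝ × ℝ) := unitLaw.prod (unitLaw.prod unitLaw)

/-- `unitLaw3` is a probability measure. -/
instance isProbabilityMeasure_unitLaw3 : IsProbabilityMeasure unitLaw3 := by
  unfold unitLaw3; infer_instance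

/-- The Kennedy–Pendleton exponent `X(r₁,r₂,r₃) = −(log r₁ + c·c·log r₃)`, `c = cos(2π r₂)` — the
engine's `-(log(r1) + c*c*log(r3))`, so that `λ² = X/(2·bt)` and `a₀ = 1 − 2λ² = 1 − X/bt`. -/
noncomputable def kpX (r : ℝ × ℝ × ℝ) : ℝ :=
  -(Real.log r.1 + Real.cos (2 * π * r.2.1) * Real.cos (2 * π * r.2.1) * Real.log r.2.2)

/-- `kpX` is measurable. -/
theorem measurable_kpX : Measurable kpX := by
  unfold kpX; fun_prop

/-- `kpX` as a sum of the exponential and the half-gamma summands. -/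
theorem kpX_eq (r : ℝ × ℝ × ℝ) :
    kpX r = -Real.log r.1 + Real.cos (2 * π * r.2.1) ^ 2 * -Real.log r.2.2 := by
  unfold kpX; ring

/-- **The Kennedy–Pendleton exponent is a Gamma(3/2) variable.**  For every measurable `g ≥ 0`,
`∫ g(kpX r) d unitLaw3(r) = ∫_{(0,∞)} (2/√π) √s e^{−s} g(s) ds`. -/
theorem lintegral_kpX {g : ℝ → ℝ≥0∞} (hg : Measurable g) :
    ∫⁻ r, g (kpX r) ∂unitLaw3 =
      ∫⁻ s in Ioi 0, ENNReal.ofReal (2 / Real.sqrt π * Real.sqrt s * Real.exp (-s)) * g s := by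
  simp_rw [kpX_eq]
  rw [unitLaw3, lintegral_prod _ (by fun_prop : Measurable fun r : ℝ × ℝ × ℝ =>
    g (-Real.log r.1 + Real.cos (2 * π * r.2.1) ^ 2 * -Real.log r.2.2)).aemeasurable]
  have h1 : ∀ r₁ : ℝ,
      ∫⁻ q, g (-Real.log r₁ + Real.cos (2 * π * q.1) ^ 2 * -Real.log q.2) ∂(unitLaw.prod unitLaw) =
        ∫⁻ y in Ioi 0, ENNReal.ofReal (Real.exp (-y) / Real.sqrt (π * y)) * g (-Real.log r₁ + y) :=
    fun r₁ => lintegral_cos_sq_mul_neg_log (g := fun y => g (-Real.log r₁ + y)) (by fun_prop)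
  simp_rw [h1]
  rw [lintegral_neg_log_unitLaw (fun x => ∫⁻ y in Ioi 0,
    ENNReal.ofReal (Real.exp (-y) / Real.sqrt (π * y)) * g (x + y))]
  exact lintegral_exp_conv_halfGamma hg

/-! ## §4 Dictionary: this is Mathlib's `gammaMeasure (3/2) 1` -/

/-- Mathlib's Gamma(3/2, 1) density is `(2/√π) √x e^{−x}` for `x ≥ 0` (`Γ(3/2) = √π/2`). -/
theorem gammaPDFReal_three_halves {x : ℝ} (hx : 0 ≤ x) :
    ProbabilityTheory.gammaPDFReal (3 / 2) 1 x = 2 / Real.sqrt π * Real.sqrt x * Real.exp (-x) := by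
  rw [ProbabilityTheory.gammaPDFReal, if_pos hx, Real.one_rpow, one_mul,
    show (3 / 2 : ℝ) - 1 = 1 / 2 by norm_num, ← Real.sqrt_eq_rpow,
    show (3 / 2 : ℝ) = 1 / 2 + 1 by norm_num, Real.Gamma_add_one (by norm_num), Real.Gamma_one_half_eq]
  have hsπ : 0 < Real.sqrt π := Real.sqrt_pos.mpr pi_pos
  field_simp

/-- **Dictionary.**  The law of the Kennedy–Pendleton exponent of three independent uniforms is
Mathlib's Gamma law with shape `3/2` and rate `1`: `unitLaw3.map kpX = gammaMeasure (3/2) 1`. -/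
theorem map_kpX_unitLaw3 : unitLaw3.map kpX = ProbabilityTheory.gammaMeasure (3 / 2) 1 := by
  ext s hs
  rw [Measure.map_apply measurable_kpX hs, ← lintegral_indicator_one (measurable_kpX hs),
    ProbabilityTheory.gammaMeasure, withDensity_apply _ hs, ← lintegral_indicator hs]
  have hind : (fun r => (kpX ⁻¹' s).indicator (1 : ℝ × ℝ × ℝ → ℝ≥0∞) r) =
      fun r => s.indicator (1 : ℝ → ℝ≥0∞) (kpX r) := by
    funext r
    simp only [Set.indicator, mem_preimage, Pi.one_apply]
    rfl
  rw [hind, lintegral_kpX (g := s.indicator 1) (measurable_one.indicator hs),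
    ← lintegral_indicator measurableSet_Ioi]
  refine lintegral_congr fun x => ?_
  by_cases hx : 0 < x
  · rw [indicator_of_mem (mem_Ioi.mpr hx)]
    by_cases hxs : x ∈ s
    · rw [indicator_of_mem hxs, indicator_of_mem hxs, Pi.one_apply, mul_one,
        ProbabilityTheory.gammaPDF, gammaPDFReal_three_halves hx.le]
    · rw [indicator_of_notMem hxs, indicator_of_notMem hxs, mul_zero]
  · rw [indicator_of_notMem (fun h : x ∈ Ioi (0 : ℝ) => hx h)]
    by_cases hxs : x ∈ s
    · rw [indicator_of_mem hxs, ProbabilityTheory.gammaPDF]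
      rcases (not_lt.mp hx).eq_or_lt with h0 | hneg
      · rw [h0, gammaPDFReal_three_halves le_rfl, Real.sqrt_zero, mul_zero, zero_mul,
          ENNReal.ofReal_zero]
      · rw [ProbabilityTheory.gammaPDFReal, if_neg (not_le.mpr hneg), ENNReal.ofReal_zero]
    · rw [indicator_of_notMem hxs]

end Summit.Ventures.LatticeQCDFlow.Exactness
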